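import Literature.NumberTheory.Automorphic.ArchRankOneJumpZeroCayley         -- ★ p850055 (this seat): the one-sided values ∕ jump on `U(Φ₂)_w` in the Cayley frame
import HarnessLib

/-!
# The STABLE (two-flip) normalised sum at a compact wall of `U(Φ₂)_w` jumps by `2i · C₁ ·` (cone integral): Shelstad's `2i`, Bouaziz's `d(s) = 2`
# (Shelstad 1979 Lemma 4.3 p. 25, Thm. 4.7 (IIIb); Bouaziz 1994 §6.2 p. 591; Varadarajan 1989 §6.4 Thm 23)

Topic `NumberTheory/Automorphic`; namespaces `Literature.NumberTheory.Automorphic` (§1, scalar∕filter algebra) and `…Automorphic.UnitaryGroup` (§2).  THEOREMS ONLY (no `def`,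
no instance, no notation, no axiom, no named fact, no `sorry`).  Cell `pub/hodgecm-mathlib`, line LH3 (closer stub `stub_N9`, crux H413 = `stmt-HodgeConjecture-24833`), DIRECT
ROAD organ **(J-H) «ORDER-0 (I₃) for the genuine stable families of `H_∞`»** (LH3-plan (g3) 2026-09-02T07:18:44Z «(J-H) ORDER-0 HEAD» → LH10-p02 (g3)): this file is the
BINDER-FREE `w₀`-FACTOR of that head (census 07:3xZ (2)).  The (T-ATLAS) stable orbital family ★ `stOrbFamH L νH fH S = bzExtend S (archRH S · stableSum S (chartOrbH …))`
read along the normal curve `ν ↦ s + ν • nrm w₀` of the noncompact imaginary wall `θ₀ = θ₂` at a compact place `w₀ ∉ S` has, at `w₀`, the local factor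
`r_{w₀}(ν) · [φ_{w₀}(θ₀+ν, ·, θ₀−ν) + φ_{w₀}(θ₀−ν, ·, θ₀+ν)]` — the Weyl normaliser `r_{w₀} = 1 − e^{i(θ₂−θ₀)} = 1 − e^{−2iν}` of ★ `archRH` times the SUM over the two flips
(★ `stableSum`, `flipSet`) of the chart orbital functional at the Cayley torus point `P·diag(z e^{±iν}, z e^{∓iν})·P⁻¹`, `z = e^{iθ₀}` — all other factors being constant in `ν`.

THE MATHEMATICS.  With `Φ(ν) := ∫_{U(Φ₂)_w} f(h·(P diag(z e^{iν}, z e^{−iν}) P⁻¹)·h⁻¹) dν_w` and `g(ν) := 2 sin ν · Φ(ν)` (★ p850055: `g → C₁·L⁺` at `0⁺`, `g → C₁·L⁻` at `0⁻`,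
`L⁺ − L⁻ =` the two-nappe cone integral of `f` at `z·1` in the Cayley frame):  `1 − e^{−2iν} = i e^{−iν} · 2 sin ν` (§1), hence
`(1 − e^{−2iν}) · (Φ(ν) + Φ(−ν)) = i e^{−iν} · (g(ν) − g(−ν))` (§1 `one_sub_cexp_mul_add_eq`), whose one-sided limits are `± i · C₁ (L⁺ − L⁻)` (§1
`HasOneSidedJump.reflect_sub`: a function with one-sided limits `Lp, Lm` gives `ν ↦ i e^{−iν}(g(ν) − g(−ν))` the one-sided limits `i(Lp − Lm)`, `i(Lm − Lp)`), so the
stable normalised sum JUMPS BY `2i · C₁ · (L⁺ − L⁻)` — twice the one-flip jump, with Shelstad's `2i` (`lim_{ν↓0} − lim_{ν↑0} = 2i · Ψ^{T_s}(γ₀^s)`) ∕ Bouaziz's stable `d(s) = 2`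
(§6.2) produced by the bookkeeping, not postulated (§2).
HONEST LABEL: HC_CM is proved only modulo the 7 printed citations (2 remaining: hLiu418 = stmt-HodgeConjecture-24832, h413 = stmt-HodgeConjecture-24833) until rung 0 closes;
count-neutral; the remaining binders of the (J-H) head ((PROD-QUOT-H) product form + compact-place quotient rider, (I₂@cayPt), (A0-b)∕(A0-c)) are NOT touched here.

WHAT IS PROVED.  §1 `one_sub_cexp_two_mul_eq` (`1 − e^{−2iν} = i e^{−iν}·(2 sin ν)`), `one_sub_cexp_mul_add_eq` (the reflect identity for any `Φ : ℝ → ℂ`), `HasOneSidedJump.congr`,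
**`HasOneSidedJump.reflect_sub`** (`HasOneSidedJump g J → HasOneSidedJump (ν ↦ i e^{−iν}(g ν − g(−ν))) (2iJ)`), **`HasOneSidedJump.stableSum_of_two_sin_mul`** (generic: one-flip
jump `J` of `2 sin ψ · Φ ψ` ⇒ stable jump `2iJ`).  §2 **`exists_hasOneSidedJump_stableSum_cayley (L) (w) (ν)`**:
`∃ C₁ > 0, ∀ f continuous cpt-supp, ∀ z : Circle, HasOneSidedJump (ν ↦ (1 − e^{−2iν})·(Φ(ν) + Φ(−ν))) (2 I · C₁ · (∫⁺ + ∫⁻))` with ★ p850055's constant and cone values.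

## References
* [Shelstad1979] D. Shelstad, *Characters and inner forms of a quasi-split group over ℝ*, Compositio Math. 39 (1979), Lemma 4.3 p. 25, Thm. 4.7 (IIIb) p. 31 (the `2i`).
* [Bouaziz1994IntegralesOrbitales] A. Bouaziz, *Intégrales orbitales sur les groupes de Lie réductifs*, Ann. Sci. ÉNS 27 (1994), §3.2 (I₃) p. 580, §6.2 p. 591 (`d(s) = 2` stable).
* [Varadarajan1989] V. S. Varadarajan, *An Introduction to Harmonic Analysis on Semisimple Lie Groups* (1989), §6.4 Thm 23.
* [Rogawski1990] J. D. Rogawski, *Automorphic Representations of Unitary Groups in Three Variables* (1990), §4.1 (4.1.1) p. 39 (`Φ^st`), §8.2 pp. 119, 122.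
-/

set_option autoImplicit false

noncomputable section

namespace Literature.NumberTheory.Automorphic

open _root_.MeasureTheory Set Filter _root_.Topology _root_.Complex
open Literature.NumberTheory.Automorphic.Shelstad1979.StableOrbitalIntegrals
open scoped Real

/-! ## §1 Scalar and filter algebra of the reflection `ν ↦ −ν` -/

/-- `1 − e^{−2iν} = i · e^{−iν} · (2 sin ν)`. [cite: Shelstad1979, Lemma 4.3 p. 25] -/
theorem one_sub_cexp_two_mul_eq (ν : ℝ) :
    (1 : ℂ) - cexp (-(2 * (ν : ℂ) * I)) = I * cexp (-((ν : ℂ) * I)) * (2 * Real.sin ν : ℂ) := by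
  have hab : cexp ((ν : ℂ) * I) * cexp (-((ν : ℂ) * I)) = 1 := by
    rw [← Complex.exp_add, add_neg_cancel, Complex.exp_zero]
  have h2 : cexp (-(2 * (ν : ℂ) * I)) = cexp (-((ν : ℂ) * I)) * cexp (-((ν : ℂ) * I)) := by
    rw [← Complex.exp_add]; congr 1; ring
  have hsin : (2 * Real.sin ν : ℂ) = (cexp (-((ν : ℂ) * I)) - cexp ((ν : ℂ) * I)) * I := by
    rw [← Complex.ofReal_ofNat, ← Complex.ofReal_mul, Complex.ofReal_mul, Complex.ofReal_sin, Complex.ofReal_ofNat, Complex.two_sin, neg_mul]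
  rw [h2, hsin]
  linear_combination (cexp ((ν : ℂ) * I) * cexp (-((ν : ℂ) * I)) - cexp (-((ν : ℂ) * I)) * cexp (-((ν : ℂ) * I))) * Complex.I_mul_I - hab

/-- **The reflect identity**: `(1 − e^{−2iν}) · (Φ(ν) + Φ(−ν)) = i e^{−iν} · (2 sin ν · Φ(ν) − 2 sin(−ν) · Φ(−ν))` for any `Φ : ℝ → ℂ` — the Weyl normaliser `r = 1 − e^{i(θ₂−θ₀)}` times the
two-flip sum equals `i e^{−iν}` times the DIFFERENCE of the `2 sin`-normalised function at `±ν`. [cite: Shelstad1979, Lemma 4.3 p. 25] [cite: Bouaziz1994IntegralesOrbitales, §6.2 p. 591] -/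
theorem one_sub_cexp_mul_add_eq (Φ : ℝ → ℂ) (ν : ℝ) :
    ((1 : ℂ) - cexp (-(2 * (ν : ℂ) * I))) * (Φ ν + Φ (-ν)) =
      I * cexp (-((ν : ℂ) * I)) * ((2 * Real.sin ν : ℂ) * Φ ν - (2 * Real.sin (-ν) : ℂ) * Φ (-ν)) := by
  rw [one_sub_cexp_two_mul_eq, Real.sin_neg]
  push_cast
  ring

/-- `HasOneSidedJump` is invariant under pointwise equality of the function. [cite: Shelstad1979, §4 p. 22] -/
theorem HasOneSidedJump.congr {F G : ℝ → ℂ} {J : ℂ} (h : HasOneSidedJump F J) (hFG : ∀ ν, F ν = G ν) : HasOneSidedJump G J := by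
  obtain rfl : F = G := funext hFG
  exact h

/-- **THE REFLECTION DOUBLES THE JUMP**: if `g` has one-sided limits `Lp, Lm` at `0` with `Lp − Lm = J`, then `ν ↦ i e^{−iν} · (g(ν) − g(−ν))` has one-sided limits `i(Lp − Lm)`,
`i(Lm − Lp)` and jumps by `2i · J` (`g(−ν) → Lm` as `ν → 0⁺`, `→ Lp` as `ν → 0⁻`; `e^{−iν} → 1`). [cite: Shelstad1979, Lemma 4.3 p. 25; Thm. 4.7 (IIIb) p. 31] -/
theorem HasOneSidedJump.reflect_sub {g : ℝ → ℂ} {J : ℂ} (h : HasOneSidedJump g J) :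
    HasOneSidedJump (fun ν : ℝ => I * cexp (-((ν : ℂ) * I)) * (g ν - g (-ν))) (2 * I * J) := by
  obtain ⟨Lp, Lm, hp, hm, hJ⟩ := h
  have hnegp : Tendsto (fun ν : ℝ => -ν) (𝓝[>] (0 : ℝ)) (𝓝[<] 0) := by
    simpa using tendsto_neg_nhdsGT (a := (0 : ℝ))
  have hnegm : Tendsto (fun ν : ℝ => -ν) (𝓝[<] (0 : ℝ)) (𝓝[>] 0) := by
    simpa using tendsto_neg_nhdsLT (a := (0 : ℝ))
  have hexp : Tendsto (fun ν : ℝ => I * cexp (-((ν : ℂ) * I))) (𝓝 (0 : ℝ)) (𝓝 I) := by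
    have hc : Continuous fun ν : ℝ => I * cexp (-((ν : ℂ) * I)) := by fun_prop
    have h0 := hc.tendsto 0
    simpa using h0
  refine ⟨I * (Lp - Lm), I * (Lm - Lp), ?_, ?_, by rw [← hJ]; ring⟩
  · have h1 := (hexp.mono_left nhdsWithin_le_nhds).mul (hp.sub (hm.comp hnegp))
    exact h1
  · have h1 := (hexp.mono_left nhdsWithin_le_nhds).mul (hm.sub (hp.comp hnegm))
    exact h1

/-- **THE STABLE NORMALISED SUM JUMPS TWICE**: if the one-flip normalised function `ψ ↦ 2 sin ψ · Φ(ψ)` has one-sided limits at `0` with jump `J`, then the Weyl-normalised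
two-flip sum `ν ↦ (1 − e^{−2iν}) · (Φ(ν) + Φ(−ν))` has one-sided limits at `0` with jump `2i · J`. [cite: Shelstad1979, Lemma 4.3 p. 25; Thm. 4.7 (IIIb) p. 31]
[cite: Bouaziz1994IntegralesOrbitales, §6.2 p. 591] -/
theorem HasOneSidedJump.stableSum_of_two_sin_mul {Φ : ℝ → ℂ} {J : ℂ} (h : HasOneSidedJump (fun ψ : ℝ => (2 * Real.sin ψ : ℂ) * Φ ψ) J) :
    HasOneSidedJump (fun ν : ℝ => ((1 : ℂ) - cexp (-(2 * (ν : ℂ) * I))) * (Φ ν + Φ (-ν))) (2 * I * J) :=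
  HasOneSidedJump.congr (HasOneSidedJump.reflect_sub h) fun ν => (one_sub_cexp_mul_add_eq Φ ν).symm

end Literature.NumberTheory.Automorphic

/-! ## §2 The stable normalised sum at a compact wall of `U(Φ₂)_w` -/

namespace Literature.NumberTheory.Automorphic.UnitaryGroup

open _root_.MeasureTheory Set Filter _root_.Topology _root_.Complex _root_.NumberField _root_.NumberField.InfinitePlace
open Literature.NumberTheory.Automorphic.Shelstad1979.StableOrbitalIntegrals
open scoped Real MatrixGroups

variable (L : Type) [Field L] (w : {w : InfinitePlace L // IsComplex w})

/-- **THE `w₀`-FACTOR OF THE (J-H) ORDER-0 HEAD, BINDER-FREE.**  For every Haar measure `ν` on `U(Φ₂)_w = archLocal L 2 Φ₂ w` there is ONE `C₁ > 0` (★ p850055's) such that for every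
continuous compactly supported `f : M₂(ℂ) → ℂ` and every `z ∈ S¹`, with `Φ(ν) := ∫_{U(Φ₂)_w} f(h·(P diag(z e^{iν}, z e^{−iν}) P⁻¹)·h⁻¹) dν(h)` (the Cayley torus = ★ `endoBlock`'s
compact chart along the normal curve of the wall `θ₀ = θ₂`, `z = e^{iθ₀}`), the STABLE NORMALISED SUM `ν ↦ (1 − e^{−2iν}) · (Φ(ν) + Φ(−ν))` — ★ `archRH`'s place factor
`1 − e^{i(θ₂−θ₀)}` times the sum over the two flips of ★ `stableSum` — has both one-sided limits at `ν = 0` and JUMPS BY `2i · C₁ · (∫⁺ + ∫⁻)`, the two-nappe cone integral of `f` at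
`z·1` in the Cayley frame (★ p850055 ∕ p849935 values): Shelstad's `2i`, Bouaziz's `d(s) = 2`. [cite: Shelstad1979, Lemma 4.3 p. 25; Thm. 4.7 (IIIb) p. 31]
[cite: Bouaziz1994IntegralesOrbitales, §6.2 p. 591] [cite: Varadarajan1989, §6.4 Thm 23] -/
theorem exists_hasOneSidedJump_stableSum_cayley
    [MeasurableSpace (archLocal L 2 (Matrix.of fun i j : Fin 2 => if i.val + j.val + 1 = 2 then (1 : L) else 0) w)]
    [BorelSpace (archLocal L 2 (Matrix.of fun i j : Fin 2 => if i.val + j.val + 1 = 2 then (1 : L) else 0) w)]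
    (ν : Measure (archLocal L 2 (Matrix.of fun i j : Fin 2 => if i.val + j.val + 1 = 2 then (1 : L) else 0) w)) [ν.IsHaarMeasure] :
    ∃ C₁ : ℝ, 0 < C₁ ∧
      ∀ (f : Matrix (Fin 2) (Fin 2) ℂ → ℂ), Continuous f → HasCompactSupport f → ∀ z : Circle,
        HasOneSidedJump (fun t : ℝ => ((1 : ℂ) - cexp (-(2 * (t : ℂ) * I))) *
            ((∫ h : archLocal L 2 (Matrix.of fun i j : Fin 2 => if i.val + j.val + 1 = 2 then (1 : L) else 0) w,
                f (((h * ⟨Matrix.GeneralLinearGroup.mkOfDetNeZero !![(1 : ℂ), 1; 1, -1] det_cayleyTwo_ne_zero *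
                      circleDiagonal 2 ![z * Circle.exp t, z * Circle.exp (-t)] *
                      (Matrix.GeneralLinearGroup.mkOfDetNeZero !![(1 : ℂ), 1; 1, -1] det_cayleyTwo_ne_zero)⁻¹,
                    cayley_conj_circleDiagonal_mem_archLocal L w _⟩ * h⁻¹ :
                  archLocal L 2 (Matrix.of fun i j : Fin 2 => if i.val + j.val + 1 = 2 then (1 : L) else 0) w) : GL (Fin 2) ℂ) : Matrix (Fin 2) (Fin 2) ℂ) ∂ν) +
             (∫ h : archLocal L 2 (Matrix.of fun i j : Fin 2 => if i.val + j.val + 1 = 2 then (1 : L) else 0) w,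
                f (((h * ⟨Matrix.GeneralLinearGroup.mkOfDetNeZero !![(1 : ℂ), 1; 1, -1] det_cayleyTwo_ne_zero *
                      circleDiagonal 2 ![z * Circle.exp (-t), z * Circle.exp (-(-t))] *
                      (Matrix.GeneralLinearGroup.mkOfDetNeZero !![(1 : ℂ), 1; 1, -1] det_cayleyTwo_ne_zero)⁻¹,
                    cayley_conj_circleDiagonal_mem_archLocal L w _⟩ * h⁻¹ :
                  archLocal L 2 (Matrix.of fun i j : Fin 2 => if i.val + j.val + 1 = 2 then (1 : L) else 0) w) : GL (Fin 2) ℂ) : Matrix (Fin 2) (Fin 2) ℂ) ∂ν)))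
          (2 * I * ((C₁ : ℂ) * ((∫ p in Ioi (0 : ℝ) ×ˢ Ioc (0 : ℝ) (2 * π),
              f ((!![(1 : ℂ), 1; 1, -1] : Matrix (Fin 2) (Fin 2) ℂ) *
                ((z : ℂ) • (1 : Matrix (Fin 2) (Fin 2) ℂ) + p.1 • Matrix.diagonal ![(z : ℂ) * I, -((z : ℂ) * I)] +
                  p.1 • !![(0 : ℂ), -((z : ℂ) * I) * cexp (-((p.2 : ℂ) * I)); ((z : ℂ) * I) * cexp ((p.2 : ℂ) * I), 0]) *
                !![(1 / 2 : ℂ), 1 / 2; 1 / 2, -(1 / 2)])) +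
            ∫ p in Ioi (0 : ℝ) ×ˢ Ioc (0 : ℝ) (2 * π),
              f ((!![(1 : ℂ), 1; 1, -1] : Matrix (Fin 2) (Fin 2) ℂ) *
                ((z : ℂ) • (1 : Matrix (Fin 2) (Fin 2) ℂ) + p.1 • Matrix.diagonal ![-((z : ℂ) * I), (z : ℂ) * I] +
                  p.1 • !![(0 : ℂ), ((z : ℂ) * I) * cexp (-((p.2 : ℂ) * I)); -((z : ℂ) * I) * cexp ((p.2 : ℂ) * I), 0]) *
                !![(1 / 2 : ℂ), 1 / 2; 1 / 2, -(1 / 2)])))) := by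
  obtain ⟨C₁, hC₁, h⟩ := exists_hasOneSidedJump_two_sin_mul_orbitalIntegral_cayley L w ν
  refine ⟨C₁, hC₁, fun f hf hfc z => ?_⟩
  -- the one-flip normalised function jumps by `C₁ · (∫⁺ + ∫⁻)` (★ p850055); the reflection doubles it (§1)
  exact Literature.NumberTheory.Automorphic.HasOneSidedJump.stableSum_of_two_sin_mul (h f hf hfc z)

end Literature.NumberTheory.Automorphic.UnitaryGroup

end
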